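import Summits.QuantumFields.GaugeBoot.DiagonalRPTorusTubeCoverOdd
import Summits.QuantumFields.GaugeBoot.DiagonalRPTorusTubeEstimate
import HarnessLib

/-!
# The short tube of the odd torus: leading order `β⁴ c₁⁵ N` (gauge-boot, L3 sequel, odd case 3/4)

HONEST FRAMING (cell `pub-gaugeboot`, page 1 of every file): the venture produces certified bounds
on lattice expectations at stated coupling, gauge group, dimension and torus size; NOT a mass gap,
NOT a continuum limit, NOT a string tension; NOT Yang–Mills-summit-bearing (barriers
`FixedCouplingUltralocality`, `PerturbativeInvisibility`). This module is bookkeeping for a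
structural NEGATIVE result (`DiagonalRPTorusClosedHalfNegativeHighDim`); it discharges nothing by
itself.

## Content (torus `(ℤ/L)^d`, `L ≥ 3`, directions `m < k < l`, compact metrisable `G`, continuous
`ρ` with (R1))

* `ringSet m x` — the four ring faces `ring m x ·` as a `Finset` (`card_ringSet`, `prod_ringSet`);
* `abs_pairT_sub_le_card` — `|T_Q(u,v) - β^{|Q|} ∫ Re χ(U_u) Re χ(U_v) ∏_Q Re χ(U_q)|
  ≤ N² 2^{|Q|} (βN)^{|Q|+1}` for every `Q` (general form of `abs_pairT_sub_le_of_card`);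
* `ring_integral_eq` — `∫ Re χ(U_{sq (x+e_m)}) Re χ(U_{sq x}) ∏ₐ Re χ(U_{ring m x a}) = c₁⁵ N`
  (one ring collapse and the square integral);
* ★ **`pairT_ringSet_ge`** — `T_{ring}(sq (x + e_m), sq x) ≥ β⁴ c₁⁵ N - N² 2⁴ (βN)⁵`;
* the odd-torus witness geometry: `ringSet_i_subset_odd`, `ringSet_j_subset_odd`.

Elementary bookkeeping; no named fact.
-/

open MeasureTheory Finset Function

namespace Summit.QuantumFields.GaugeBoot

open Literature.MathematicalPhysics.QuantumFieldTheory
open Literature.MathematicalPhysics.QuantumFieldTheory.PlaquetteLowerBound (reTr)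
open Summit.Ventures.YMGap.RobustBall (one_ne_zero_of_three_le two_ne_zero_of_three_le)

noncomputable section

namespace DiagRPTube

variable {d L : ℕ}

/-! ## The ring as a set of four faces -/

section RingSet

variable {m k l : Fin d} (hmk : m < k) (hml : m < l) (hkl : k < l)

/-- The four ring faces between the squares at `x` and `x + e_m`. -/
def ringSet (x : Site d L) : Finset (Plaquette d L) := univ.image (ring hmk hml x)

include hkl in
/-- **The ring has four faces.** -/
theorem card_ringSet (hL : 3 ≤ L) (x : Site d L) : (ringSet hmk hml x).card = 4 := by
  unfold ringSet
  rw [card_image_of_injective _ (ring_injective hmk hml hkl hL x)]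
  simp

include hkl in
/-- A product over the ring set is the product over the four faces. -/
theorem prod_ringSet (hL : 3 ≤ L) (x : Site d L) (f : Plaquette d L → ℝ) :
    ∏ q ∈ ringSet hmk hml x, f q = ∏ a : Fin 4, f (ring hmk hml x a) := by
  unfold ringSet
  rw [prod_image fun a _ b _ h => ring_injective hmk hml hkl hL x h]

end RingSet

/-! ## Leading order -/

section Leading

variable [NeZero L] {N : ℕ} {G : Type*} [Group G] [TopologicalSpace G]
  [IsTopologicalGroup G] [CompactSpace G] [MeasurableSpace G] [BorelSpace G]
  [SecondCountableTopology G] (ρ : G →* Matrix (Fin N) (Fin N) ℂ)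

/-- **Leading order of a pair term**, general form:
`|T_Q(u,v) - β^{|Q|} ∫ Re χ(U_u) Re χ(U_v) ∏_{q ∈ Q} Re χ(U_q)| ≤ N² 2^{|Q|} (βN)^{|Q|+1}`. -/
theorem abs_pairT_sub_le_card (hρ : Continuous ρ) {β : ℝ} (hβ : 0 ≤ β) (hβN : β * N ≤ 1)
    (Q : Finset (Plaquette d L)) (u v : Plaquette d L) :
    |pairT ρ β Q u v - β ^ Q.card * ∫ U, WilsonRP.plaqRe ρ U u * WilsonRP.plaqRe ρ U v *
        ∏ q ∈ Q, WilsonRP.plaqRe ρ U q ∂Measure.pi (fun _ : Edge d L => haarProbability G)| ≤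
      N ^ 2 * (2 ^ Q.card * (β * N) ^ (Q.card + 1)) := by
  have hpow : ∀ U : GaugeConfig d L G, β ^ Q.card * ∏ q ∈ Q, WilsonRP.plaqRe ρ U q =
      ∏ q ∈ Q, β * WilsonRP.plaqRe ρ U q := fun U => by
    rw [prod_mul_distrib, prod_const]
  have hcont : Continuous fun U : GaugeConfig d L G =>
      WilsonRP.plaqRe ρ U u * WilsonRP.plaqRe ρ U v * ∏ q ∈ Q, WilsonRP.plaqRe ρ U q :=
    ((continuous_plaqRe ρ hρ u).mul (continuous_plaqRe ρ hρ v)).mul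
      (continuous_finsetProd _ fun q _ => continuous_plaqRe ρ hρ q)
  have hI2 : Integrable (fun U : GaugeConfig d L G => β ^ Q.card *
      (WilsonRP.plaqRe ρ U u * WilsonRP.plaqRe ρ U v * ∏ q ∈ Q, WilsonRP.plaqRe ρ U q))
      (Measure.pi fun _ : Edge d L => haarProbability G) := (integrable_of_continuous hcont).const_mul _
  unfold pairT
  rw [← integral_const_mul, ← integral_sub (integrable_of_continuous
      (continuous_pairIntegrand ρ β hρ _ _ _)) hI2]
  have hbd : ∀ U : GaugeConfig d L G,
      ‖WilsonRP.plaqRe ρ U u * WilsonRP.plaqRe ρ U v * ∏ q ∈ Q, gfac ρ β q U -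
        β ^ Q.card * (WilsonRP.plaqRe ρ U u * WilsonRP.plaqRe ρ U v *
          ∏ q ∈ Q, WilsonRP.plaqRe ρ U q)‖ ≤
      N ^ 2 * (2 ^ Q.card * (β * N) ^ (Q.card + 1)) := fun U => by
    have hfold : β ^ Q.card * (WilsonRP.plaqRe ρ U u * WilsonRP.plaqRe ρ U v *
        ∏ q ∈ Q, WilsonRP.plaqRe ρ U q) =
        WilsonRP.plaqRe ρ U u * WilsonRP.plaqRe ρ U v * ∏ q ∈ Q, β * WilsonRP.plaqRe ρ U q := by
      rw [← hpow]; ring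
    rw [hfold, ← mul_sub, Real.norm_eq_abs, abs_mul, abs_mul]
    have hP := WilsonRP.abs_plaqRe_le ρ hρ U u
    have hQ' := WilsonRP.abs_plaqRe_le ρ hρ U v
    have hdiff := DiagRPSUN.abs_prod_add_sub_prod_le Q (fun q => β * WilsonRP.plaqRe ρ U q)
      (fun q => gfac ρ β q U - β * WilsonRP.plaqRe ρ U q) (t := β * N) (by positivity) hβN
      (fun q _ => by
        rw [abs_mul, abs_of_nonneg hβ]
        exact mul_le_mul_of_nonneg_left (WilsonRP.abs_plaqRe_le ρ hρ U _) hβ)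
      (fun q _ => abs_gfac_sub_le ρ β hρ hβ hβN _ U)
    simp only [add_sub_cancel] at hdiff
    calc |WilsonRP.plaqRe ρ U u| * |WilsonRP.plaqRe ρ U v| *
          |∏ q ∈ Q, gfac ρ β q U - ∏ q ∈ Q, β * WilsonRP.plaqRe ρ U q|
        ≤ N * N * (2 ^ Q.card * (β * N) ^ (Q.card + 1)) :=
          mul_le_mul (mul_le_mul hP hQ' (abs_nonneg _) (Nat.cast_nonneg _)) hdiff
            (abs_nonneg _) (by positivity)
      _ = N ^ 2 * (2 ^ Q.card * (β * N) ^ (Q.card + 1)) := by ring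
  have h := norm_integral_le_of_norm_le_const
    (μ := Measure.pi fun _ : Edge d L => haarProbability G) (ae_of_all _ hbd)
  rwa [probReal_univ, mul_one, Real.norm_eq_abs] at h

variable {m k l : Fin d} (hmk : m < k) (hml : m < l) (hkl : k < l)

include hkl in
/-- **The ring value**: `∫ Re χ(U_{sq (x+e_m)}) Re χ(U_{sq x}) ∏ₐ Re χ(U_{ring m x a}) = c₁⁵ N`. -/
theorem ring_integral_eq (hL : 3 ≤ L) (hρ : Continuous ρ) {c₁ : ℝ}
    (hR1 : ∀ x y : G, ∫ g, reTr ρ (x * g⁻¹) * reTr ρ (g * y) ∂haarProbability G = c₁ * reTr ρ (x * y))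
    (x : Site d L) :
    ∫ U, WilsonRP.plaqRe ρ U (sq k l hkl (x.shift m)) * WilsonRP.plaqRe ρ U (sq k l hkl x) *
        ∏ a : Fin 4, WilsonRP.plaqRe ρ U (ring hmk hml x a)
        ∂Measure.pi (fun _ : Edge d L => haarProbability G) = c₁ ^ 5 * N := by
  have h1 : (1 : ZMod L) ≠ 0 := one_ne_zero_of_three_le hL
  have hm1 : (x.shift m) m = x m + 1 := WilsonRP.shift_apply_self x m
  have hH : Continuous fun U : GaugeConfig d L G => WilsonRP.plaqRe ρ U (sq k l hkl (x.shift m)) :=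
    continuous_plaqRe ρ hρ _
  have hHm : ∀ e : Edge d L, e.1 m = x m → ∀ (U : GaugeConfig d L G) (s : G),
      WilsonRP.plaqRe ρ (update U e s) (sq k l hkl (x.shift m)) =
        WilsonRP.plaqRe ρ U (sq k l hkl (x.shift m)) := fun e he U s =>
    plaqRe_sq_update_of_ne ρ hmk hml hkl (by rw [he, hm1]; intro h; apply h1; linear_combination -h) U s
  rw [ring_collapse ρ hmk hml hkl hL hρ hR1 x hH hHm, integral_plaqRe_sq_mul_self ρ hkl hL hρ hR1]
  ring

include hkl in
/-- ★ **THE SHORT TUBE TO LEADING ORDER**: for `0 ≤ β`, `βN ≤ 1` and (R1),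
`T_{ring}(sq (x + e_m), sq x) ≥ β⁴ c₁⁵ N - N² 2⁴ (βN)⁵`. -/
theorem pairT_ringSet_ge (hL : 3 ≤ L) (hρ : Continuous ρ) {c₁ : ℝ}
    (hR1 : ∀ x y : G, ∫ g, reTr ρ (x * g⁻¹) * reTr ρ (g * y) ∂haarProbability G = c₁ * reTr ρ (x * y))
    {β : ℝ} (hβ : 0 ≤ β) (hβN : β * N ≤ 1) (x : Site d L) :
    β ^ 4 * (c₁ ^ 5 * N) - N ^ 2 * (2 ^ 4 * (β * N) ^ 5) ≤
      pairT ρ β (ringSet hmk hml x) (sq k l hkl (x.shift m)) (sq k l hkl x) := by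
  have hV := ring_integral_eq ρ hmk hml hkl hL hρ hR1 x
  have hsplit : ∀ U : GaugeConfig d L G,
      WilsonRP.plaqRe ρ U (sq k l hkl (x.shift m)) * WilsonRP.plaqRe ρ U (sq k l hkl x) *
        ∏ q ∈ ringSet hmk hml x, WilsonRP.plaqRe ρ U q =
      WilsonRP.plaqRe ρ U (sq k l hkl (x.shift m)) * WilsonRP.plaqRe ρ U (sq k l hkl x) *
        ∏ a : Fin 4, WilsonRP.plaqRe ρ U (ring hmk hml x a) := fun U => by
    rw [prod_ringSet hmk hml hkl hL]
  have h := abs_pairT_sub_le_card ρ hρ hβ hβN (ringSet hmk hml x) (sq k l hkl (x.shift m)) (sq k l hkl x)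
  rw [card_ringSet hmk hml hkl hL, show (4 : ℕ) + 1 = 5 from rfl] at h
  simp_rw [hsplit] at h
  rw [hV] at h
  rw [abs_le] at h
  linarith [h.1]

end Leading

/-! ## The odd-torus witness: the rings lie in the rest -/

section Witness

variable {i j k l : Fin d} (hij : i < j) (hjk : j < k) (hkl : k < l) [NeZero L] {c : ℕ} (hc : 1 ≤ c)
  (hL : L = 2 * c + 1)
include hij hjk hkl hc hL

/-- The `+e_i` ring over a square on the layer `c` of the odd torus lies in the rest. -/
theorem ringSet_i_subset_odd {x : Site d L} (hx : lay i j x = ((c : ℕ) : ZMod L)) :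
    ringSet (hij.trans hjk) (hij.trans (hjk.trans hkl)) x ⊆ restPlaqs i j (c + 1) := by
  intro q hq
  unfold ringSet at hq
  obtain ⟨a, _, rfl⟩ := mem_image.1 hq
  exact ring_low_i_mem_odd hij hjk hkl hc hL hx a

/-- The `j`-ring based at a square on the layer `-c` of the odd torus lies in the rest. -/
theorem ringSet_j_subset_odd {z : Site d L} (hz : lay i j z = -((c : ℕ) : ZMod L)) :
    ringSet hjk (hjk.trans hkl) z ⊆ restPlaqs i j (c + 1) := by
  intro q hq
  unfold ringSet at hq
  obtain ⟨a, _, rfl⟩ := mem_image.1 hq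
  exact ring_high_j_mem_odd hij hjk hkl hc hL hz a

end Witness

end DiagRPTube

end

end Summit.QuantumFields.GaugeBoot
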